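import Summits.BirchSwinnertonDyer.BirchSwinnertonDyer.Theses.SemiOrdinaryEisensteinDescent
import Summits.BirchSwinnertonDyer.Rank1Residual.X11b.HalvesReceptacle
import HarnessLib

/-!
# Route `SemiOrdinaryEisensteinDescent`, crux #2″ of record `WildSplitEisensteinValueAtOneV` (stmt-BirchSwinnertonDyer-26610, `E_𝟙^V`):
# the L-IDLE data are PRINT-FREE — `E_𝟙^V` is EQUIVALENT to its restriction to the L-EXCESS data `‖log_ω P / c‖₃ < 1`
# (cell `pub/bsd-wall`, width seat `bsd-wall-soed-p1-w3` g16, `--supports stmt-BirchSwinnertonDyer-26610`, helper)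

WHAT. `E_𝟙^V` asks, at every Heegner datum of the onto wild r₁ cell and every anticyclotomic frame with a unit
value display `𝓛(𝟙) = u·(log_ω P/c)²` (`u ∈ R₀ˣ`), that every characteristic generator `f ∈ Λ = ℤ₃⟦T⟧` of
`X_(∅,0)` satisfies `‖f(𝟙)‖₃ ≤ ‖𝓛(𝟙)‖`. Since `f(𝟙) = f(0) ∈ ℤ₃` has norm `≤ 1` and `‖𝓛(𝟙)‖ = ‖u‖·‖log_ω P/c‖² =
‖log_ω P/c‖²`, the inequality is AUTOMATIC at every datum with `‖log_ω P/c‖₃ ≥ 1` (equivalently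
`v₃(log_ω P) ≤ v₃(c)`): the **L-idle data**. No published input, no Poitou–Tate, no control theorem, no main
conjecture enters. Hence (§2) the crux is equivalent, by pure logic, to its restriction to the **L-excess data**
`‖log_ω P/c‖₃ < 1`, where it has genuine content `ord₃ f(0) ≥ 2·(v₃(log_ω P) − v₃(c)) > 0`.

WHY RECORD IT. The sibling files reduce `E_𝟙^V` in INDEX currency (`…IndexCurrency` p614377: `E_𝟙^V ⟺ I_FH` modulo
PUB ∧ Hsieh/BDP/LZZ ∧ PT1 ∧ PT2; `…CertificateRoad` p621234 §0: the index-idle rows `ord₃[E(K):ℤP] ≤ ord₃∏c_q + v₃(c)`).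
Those idle rows need the printed dictionary to reach the crux. The L-idle rows of THIS file reach the crux's own
conclusion with NOTHING — so the research content of crux #2″, stated in the crux's own (L-) currency and free of
every print binder, is exactly: the L-excess data. Two uses: (i) the crux disprover's `-- Targets` and the
instrument row (CERT-ROAD-26610-w3g15.md §5) can be aimed at `v₃(log_ω y_K) > v₃(c)` data only; (ii) the unit bit
`v₃(log_ω y_K / c) = 0` TRANSFERS along mod-`3` congruences `W[3]^ss ≅ G[3]^ss` with unit Euler factors by
Kriz–Li 2019 Thm. 1.16 (refereed; `p = 3` split in `K`, NO hypothesis on the reduction at `3`; tree: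
`Literature.NumberTheory.EllipticCurves.KrizLi2019.thm116_padicLogHeegner_congruence`, consumer O5 node KL3-A) —
a per-pair «congruence certificate» for L-idle data, complementing the per-pair Kolyvagin certificate of the
index-excess rows (p621234 / p623400). NEITHER is a class-wide engine: on an index-excess row `y_K ∈ 3·E(K)`, so
`v₃(log_ω y_K) ≥ 1` and the datum is L-excess whenever `3 ∤ c`.

* §1 (any prime `p`, algebra in `R₀⟦T⟧`): `norm_constantCoeff_le_one` (`‖f(0)‖ ≤ 1` for `f ∈ ℤ_p⟦T⟧`);
  `norm_constantCoeff_le_of_one_le_norm_value` (`𝓛(0) = v`, `‖v‖ ≥ 1 ⟹ ‖f(0)‖ ≤ ‖𝓛(0)‖`);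
  `one_le_norm_units_mul_sq`, `norm_constantCoeff_le_of_one_le_norm_sq` (the unit-square display form).
* §2 `valueAtOneV_on_lIdle` — the crux's body with the extra binder `1 ≤ ‖log_ω P/c‖` is a THEOREM (no hypothesis);
  `valueAtOneV_iff_lExcess` — `WildSplitEisensteinValueAtOneV ↔` (its body with the extra binder `‖log_ω P/c‖ < 1`),
  both displayed as conclusion shapes (no definition introduced).

HONEST STATUS. Nothing here is progress on the ENGINE: the L-excess data are where the Eisenstein half of the
BDP main conjecture at the additive split `3` lives, and no printed engine exists there (JSW17 §7.4.1 /
Castella–Wan need `p ≥ 5` or semistable `p`; Fouquet–Wan 2107.13726 Thm. 1.12 needs `ρ_f|G_{ℚ_p}` crystalline and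
its Thm. 1.1 / Cor. 1.10 are cyclotomic / rank `0`). Supports, does not close, stmt-BirchSwinnertonDyer-26610.
BSD is not proved for any curve by any of this.
-/

noncomputable section

open scoped Classical

set_option linter.dupNamespace false -- `Summit.BirchSwinnertonDyer.BirchSwinnertonDyer.Theorems.…` (summit = sub, D-0017)
set_option autoImplicit false

namespace Summit.BirchSwinnertonDyer.BirchSwinnertonDyer.Theorems.WildSplitEisensteinValueAtOneVLIdle

open PowerSeries Literature.NumberTheory.EllipticCurves
  Summit.BirchSwinnertonDyer.Rank1Residual.X11b.Halves
  Summit.BirchSwinnertonDyer.BirchSwinnertonDyer.Theses.SemiOrdinaryEisensteinDescent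

/-! ### §1 Algebra in `R₀⟦T⟧` (any prime `p`): the value-at-`𝟙` inequality is automatic when `‖𝓛(𝟙)‖ ≥ 1` -/

section Algebra

variable (p : ℕ) [Fact p.Prime]

/-- `‖f(0)‖_p ≤ 1` for every `f ∈ Λ = ℤ_p⟦T⟧` (the constant term is a `p`-adic integer). [folklore] -/
theorem norm_constantCoeff_le_one (f : IwasawaAlgebra p) :
    ‖((constantCoeff f : ℤ_[p]) : ℚ_[p])‖ ≤ 1 := by
  rw [← PadicInt.norm_def]
  exact PadicInt.norm_le_one _

/-- If `𝓛(𝟙) = v` (a value at `T = 0`) with `‖v‖ ≥ 1`, then `‖f(0)‖ ≤ ‖𝓛(0)‖` for EVERY `f ∈ ℤ_p⟦T⟧`: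
`‖f(0)‖ ≤ 1 ≤ ‖v‖ = ‖𝓛(0)‖` (`UnrSeries.eq_constantCoeff_of_hasValueAt_zero`). [folklore] -/
theorem norm_constantCoeff_le_of_one_le_norm_value (f : IwasawaAlgebra p) {L : UnrSeries p} {v : ℂ_[p]}
    (hL : L.HasValueAt 0 v) (hv : 1 ≤ ‖v‖) :
    ‖((constantCoeff f : ℤ_[p]) : ℚ_[p])‖ ≤ ‖((constantCoeff L : unrIntegers p) : ℂ_[p])‖ := by
  rw [← UnrSeries.eq_constantCoeff_of_hasValueAt_zero hL]
  exact (norm_constantCoeff_le_one p f).trans hv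

/-- A unit-square display `u·x²` with `u ∈ R₀ˣ` and `‖x‖ ≥ 1` has norm `≥ 1` (`‖u‖ = 1`). [folklore] -/
theorem one_le_norm_units_mul_sq (u : (unrIntegers p)ˣ) {x : ℂ_[p]} (hx : 1 ≤ ‖x‖) :
    1 ≤ ‖((u : unrIntegers p) : ℂ_[p]) * x ^ 2‖ := by
  rw [norm_mul, norm_pow, norm_coe_units_unrIntegers, one_mul]
  exact one_le_pow₀ hx

/-- **The L-idle inequality.** If `𝓛(𝟙) = u·x²` with `u ∈ R₀ˣ` and `‖x‖ ≥ 1`, then `‖f(0)‖ ≤ ‖𝓛(0)‖` for every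
`f ∈ ℤ_p⟦T⟧` — no hypothesis on `f`. [folklore] -/
theorem norm_constantCoeff_le_of_one_le_norm_sq (f : IwasawaAlgebra p) {L : UnrSeries p}
    (u : (unrIntegers p)ˣ) {x : ℂ_[p]}
    (hL : L.HasValueAt 0 (((u : unrIntegers p) : ℂ_[p]) * x ^ 2)) (hx : 1 ≤ ‖x‖) :
    ‖((constantCoeff f : ℤ_[p]) : ℚ_[p])‖ ≤ ‖((constantCoeff L : unrIntegers p) : ℂ_[p])‖ :=
  norm_constantCoeff_le_of_one_le_norm_value p f hL (one_le_norm_units_mul_sq p u hx)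

end Algebra

/-! ### §2 The crux on the L-idle data (a theorem) and the equivalence with its L-excess restriction -/

/-- **`E_𝟙^V` on the L-IDLE data is a theorem.** The body of `WildSplitEisensteinValueAtOneV` with the single extra
binder `1 ≤ ‖log_ω P / c‖` (inserted before `∀ f`, every other binder VERBATIM) holds outright: by
`norm_constantCoeff_le_of_one_le_norm_sq` at the displayed value `𝓛(𝟙) = u·(log_ω P/c)²`. No published input,
no Poitou–Tate, no control, no main conjecture; most binders are unused (kept verbatim so that the shape is the
crux's). [folklore] -/
theorem valueAtOneV_on_lIdle :
    ∀ (W : WeierstrassCurve ℚ) [W.IsElliptic] [W.IsGloballyMinimal] (N : ℕ) [NeZero N] (K : Type) [Field K] [NumberField K] (Dt : Literature.NumberTheory.EllipticCurves.ModularForms.ModularParametrizationData W N) (H : Literature.NumberTheory.EllipticCurves.HeegnerDatum N (NumberField.discr K)) (ι : K →+* ℂ) (P : (W.baseChange K).toAffine.Point), Summit.BirchSwinnertonDyer.Rank1Residual.Additive.ClassO6 W 3 → W.HasSurjectiveModNGaloisRep 3 → W.analyticRank = 1 → W.conductorNorm ℤ = N → Literature.NumberTheory.EllipticCurves.IsImaginaryQuadratic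 K → Literature.NumberTheory.EllipticCurves.SatisfiesHeegnerHypothesis N K → (W.quadraticTwist (NumberField.discr K : ℚ)).entireLFunction 1 ≠ 0 → (WeierstrassCurve.Affine.Point.map ι.toRatAlgHom) P = Literature.NumberTheory.EllipticCurves.ModularForms.heegnerPointComplex Dt H → ¬ IsOfFinAddOrder P → Odd (NumberField.discr K) → ∀ (κ : Literature.NumberTheory.EllipticCurves.ZpExtension K 3), κ.IsAnticyclotomic → ∀ (γ : Field.absoluteGaloisGroup K) [Fact (κ.IsTopGenerator γ)] (𝔭 : IsDedekindDomain.HeightOneSpectrum (NumberField.RingOfIntegers K)) (h𝔭 : ((3 : ℕ) : NumberField.RingOfIntegers K) ∈ 𝔭.asIdeal) (he : 𝔭.asIdeal.ramificationIdx (NumberField.RingOfIntegers ℚ) = 1) (hf : 𝔭.asIdeal.inertiaDeg (NumberField.RingOfIntegers ℚ) = 1), ∀ (𝔭' : IsDedekindDomain.HeightOneSpectrum (NumberField.RingOfIntegers K)), ((3 : ℕ) : NumberField.RingOfIntegers K) ∈ 𝔭'.asIdeal → 𝔭' ≠ 𝔭 → ∀ (ι' : PadicAlgCl 3 ≃+*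 ℂ), Summit.BirchSwinnertonDyer.BirchSwinnertonDyer.Theorems.SchneiderFree.BranchInducesPrime 3 ι' 𝔭 → ∀ (ΩK : ℂ) (Ωp : ℂ_[3]) (L : Literature.NumberTheory.EllipticCurves.UnrSeries 3), ΩK ≠ 0 → Ωp ≠ 0 → Literature.NumberTheory.EllipticCurves.IsBDPLFunction ι' 𝔭 κ γ Dt.f ΩK Ωp L → Module.IsTorsion (Literature.NumberTheory.EllipticCurves.IwasawaAlgebra 3) (Summit.BirchSwinnertonDyer.Rank1Residual.X11b.AcSelmer.XAc (W.baseChange K) 3 κ 𝔭' ∅ γ) → ∀ (u : (Literature.NumberTheory.EllipticCurves.unrIntegers 3)ˣ), L.HasValueAt 0 ((((u : Literature.NumberTheory.EllipticCurves.unrIntegers 3) : Literature.NumberTheory.EllipticCurves.unrIntegers 3) : ℂ_[3]) * (algebraMap ℚ_[3] ℂ_[3] (Summit.BirchSwinnertonDyer.Rank1Residual.X11b.Halves.logOmega W 3 (Summit.BirchSwinnertonDyer.Rank1Residual.X11b.embAt K 3 𝔭 h𝔭 he hf) P / (Dt.c : ℚ_[3]))) ^ 2) → 1 ≤ ‖algebraMap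 ℚ_[3] ℂ_[3] (Summit.BirchSwinnertonDyer.Rank1Residual.X11b.Halves.logOmega W 3 (Summit.BirchSwinnertonDyer.Rank1Residual.X11b.embAt K 3 𝔭 h𝔭 he hf) P / (Dt.c : ℚ_[3]))‖ → ∀ (f : Literature.NumberTheory.EllipticCurves.IwasawaAlgebra 3), Summit.BirchSwinnertonDyer.Rank1Residual.X11b.AcSelmer.XAc.charIdeal (W.baseChange K) 3 κ 𝔭' ∅ γ = Ideal.span {f} → ‖((PowerSeries.constantCoeff f : ℤ_[3]) : ℚ_[3])‖ ≤ ‖((PowerSeries.constantCoeff L : Literature.NumberTheory.EllipticCurves.unrIntegers 3) : ℂ_[3])‖ := by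
  intro W _ _ N _ K _ _ Dt H ι P hO6 hsurj hr hN hK hHg hLt hP hnt hodd κ hκ γ _ 𝔭 h𝔭 he hf 𝔭' h𝔭' hne ι' hbr ΩK Ωp L hΩK hΩp hBDP htors u hval hle f _
  exact norm_constantCoeff_le_of_one_le_norm_sq 3 f u hval hle

/-- **`E_𝟙^V` ⟺ `E_𝟙^V` restricted to the L-EXCESS data `‖log_ω P / c‖₃ < 1`.** Pure logic over
`valueAtOneV_on_lIdle`: `→` is restriction; `←` splits a datum into L-excess (the hypothesis) or L-idle (the
theorem). The right-hand side is the crux body with the single extra binder `‖log_ω P / c‖ < 1` inserted before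
`∀ f` (displayed as a conclusion shape; no definition). This is the research content of crux #2″ in its own
currency. [folklore] -/
theorem valueAtOneV_iff_lExcess :
    WildSplitEisensteinValueAtOneV ↔
    (∀ (W : WeierstrassCurve ℚ) [W.IsElliptic] [W.IsGloballyMinimal] (N : ℕ) [NeZero N] (K : Type) [Field K] [NumberField K] (Dt : Literature.NumberTheory.EllipticCurves.ModularForms.ModularParametrizationData W N) (H : Literature.NumberTheory.EllipticCurves.HeegnerDatum N (NumberField.discr K)) (ι : K →+* ℂ) (P : (W.baseChange K).toAffine.Point), Summit.BirchSwinnertonDyer.Rank1Residual.Additive.ClassO6 W 3 → W.HasSurjectiveModNGaloisRep 3 → W.analyticRank = 1 → W.conductorNorm ℤ = N → Literature.NumberTheory.EllipticCurves.IsImaginaryQuadratic K → Literature.NumberTheory.EllipticCurves.SatisfiesHeegnerHypothesis N K → (W.quadraticTwist (NumberField.discr K : ℚ)).entireLFunction 1 ≠ 0 → (WeierstrassCurve.Affine.Point.map ι.toRatAlgHom) P = Literature.NumberTheory.EllipticCurves.ModularForms.heegnerPointComplex Dt H → ¬ IsOfFinAddOrder P → Odd (NumberField.discr K) → ∀ (κ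 : Literature.NumberTheory.EllipticCurves.ZpExtension K 3), κ.IsAnticyclotomic → ∀ (γ : Field.absoluteGaloisGroup K) [Fact (κ.IsTopGenerator γ)] (𝔭 : IsDedekindDomain.HeightOneSpectrum (NumberField.RingOfIntegers K)) (h𝔭 : ((3 : ℕ) : NumberField.RingOfIntegers K) ∈ 𝔭.asIdeal) (he : 𝔭.asIdeal.ramificationIdx (NumberField.RingOfIntegers ℚ) = 1) (hf : 𝔭.asIdeal.inertiaDeg (NumberField.RingOfIntegers ℚ) = 1), ∀ (𝔭' : IsDedekindDomain.HeightOneSpectrum (NumberField.RingOfIntegers K)), ((3 : ℕ) : NumberField.RingOfIntegers K) ∈ 𝔭'.asIdeal → 𝔭' ≠ 𝔭 → ∀ (ι' : PadicAlgCl 3 ≃+* ℂ), Summit.BirchSwinnertonDyer.BirchSwinnertonDyer.Theorems.SchneiderFree.BranchInducesPrime 3 ι' 𝔭 → ∀ (ΩK : ℂ) (Ωp : ℂ_[3]) (L : Literature.NumberTheory.EllipticCurves.UnrSeries 3), ΩK ≠ 0 → Ωp ≠ 0 → Literature.NumberTheory.EllipticCurves.IsBDPLFunction ι' 𝔭 κ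 γ Dt.f ΩK Ωp L → Module.IsTorsion (Literature.NumberTheory.EllipticCurves.IwasawaAlgebra 3) (Summit.BirchSwinnertonDyer.Rank1Residual.X11b.AcSelmer.XAc (W.baseChange K) 3 κ 𝔭' ∅ γ) → ∀ (u : (Literature.NumberTheory.EllipticCurves.unrIntegers 3)ˣ), L.HasValueAt 0 ((((u : Literature.NumberTheory.EllipticCurves.unrIntegers 3) : Literature.NumberTheory.EllipticCurves.unrIntegers 3) : ℂ_[3]) * (algebraMap ℚ_[3] ℂ_[3] (Summit.BirchSwinnertonDyer.Rank1Residual.X11b.Halves.logOmega W 3 (Summit.BirchSwinnertonDyer.Rank1Residual.X11b.embAt K 3 𝔭 h𝔭 he hf) P / (Dt.c : ℚ_[3]))) ^ 2) → ‖algebraMap ℚ_[3] ℂ_[3] (Summit.BirchSwinnertonDyer.Rank1Residual.X11b.Halves.logOmega W 3 (Summit.BirchSwinnertonDyer.Rank1Residual.X11b.embAt K 3 𝔭 h𝔭 he hf) P / (Dt.c : ℚ_[3]))‖ < 1 → ∀ (f : Literature.NumberTheory.EllipticCurves.IwasawaAlgebra 3), Summit.BirchSwinnertonDyer.Rank1Residual.X11b.AcSelmer.XAc.charIdeal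 (W.baseChange K) 3 κ 𝔭' ∅ γ = Ideal.span {f} → ‖((PowerSeries.constantCoeff f : ℤ_[3]) : ℚ_[3])‖ ≤ ‖((PowerSeries.constantCoeff L : Literature.NumberTheory.EllipticCurves.unrIntegers 3) : ℂ_[3])‖) := by
  constructor
  · intro h W _ _ N _ K _ _ Dt H ι P hO6 hsurj hr hN hK hHg hLt hP hnt hodd κ hκ γ _ 𝔭 h𝔭 he hf 𝔭' h𝔭' hne ι' hbr ΩK Ωp L hΩK hΩp hBDP htors u hval _ f hfg
    exact h W N K Dt H ι P hO6 hsurj hr hN hK hHg hLt hP hnt hodd κ hκ γ 𝔭 h𝔭 he hf 𝔭' h𝔭' hne ι' hbr ΩK Ωp L hΩK hΩp hBDP htors u hval f hfg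
  · intro h W _ _ N _ K _ _ Dt H ι P hO6 hsurj hr hN hK hHg hLt hP hnt hodd κ hκ γ _ 𝔭 h𝔭 he hf 𝔭' h𝔭' hne ι' hbr ΩK Ωp L hΩK hΩp hBDP htors u hval f hfg
    by_cases hlt : ‖algebraMap ℚ_[3] ℂ_[3] (Summit.BirchSwinnertonDyer.Rank1Residual.X11b.Halves.logOmega W 3 (Summit.BirchSwinnertonDyer.Rank1Residual.X11b.embAt K 3 𝔭 h𝔭 he hf) P / (Dt.c : ℚ_[3]))‖ < 1
    · exact h W N K Dt H ι P hO6 hsurj hr hN hK hHg hLt hP hnt hodd κ hκ γ 𝔭 h𝔭 he hf 𝔭' h𝔭' hne ι' hbr ΩK Ωp L hΩK hΩp hBDP htors u hval hlt f hfg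
    · exact valueAtOneV_on_lIdle W N K Dt H ι P hO6 hsurj hr hN hK hHg hLt hP hnt hodd κ hκ γ 𝔭 h𝔭 he hf 𝔭' h𝔭' hne ι' hbr ΩK Ωp L hΩK hΩp hBDP htors u hval (not_lt.mp hlt) f hfg

/-- **Corollary (the print-free reduction, implication form).** To prove crux #2″ it suffices to prove it on the
L-excess data. [folklore] -/
theorem valueAtOneV_of_lExcess
    (h : ∀ (W : WeierstrassCurve ℚ) [W.IsElliptic] [W.IsGloballyMinimal] (N : ℕ) [NeZero N] (K : Type) [Field K] [NumberField K] (Dt : Literature.NumberTheory.EllipticCurves.ModularForms.ModularParametrizationData W N) (H : Literature.NumberTheory.EllipticCurves.HeegnerDatum N (NumberField.discr K)) (ι : K →+* ℂ) (P : (W.baseChange K).toAffine.Point), Summit.BirchSwinnertonDyer.Rank1Residual.Additive.ClassO6 W 3 → W.HasSurjectiveModNGaloisRep 3 → W.analyticRank = 1 → W.conductorNorm ℤ = N → Literature.NumberTheory.EllipticCurves.IsImaginaryQuadratic K → Literature.NumberTheory.EllipticCurves.SatisfiesHeegnerHypothesis N K → (W.quadraticTwist (NumberField.discr K : ℚ)).entireLFunction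 1 ≠ 0 → (WeierstrassCurve.Affine.Point.map ι.toRatAlgHom) P = Literature.NumberTheory.EllipticCurves.ModularForms.heegnerPointComplex Dt H → ¬ IsOfFinAddOrder P → Odd (NumberField.discr K) → ∀ (κ : Literature.NumberTheory.EllipticCurves.ZpExtension K 3), κ.IsAnticyclotomic → ∀ (γ : Field.absoluteGaloisGroup K) [Fact (κ.IsTopGenerator γ)] (𝔭 : IsDedekindDomain.HeightOneSpectrum (NumberField.RingOfIntegers K)) (h𝔭 : ((3 : ℕ) : NumberField.RingOfIntegers K) ∈ 𝔭.asIdeal) (he : 𝔭.asIdeal.ramificationIdx (NumberField.RingOfIntegers ℚ) = 1) (hf : 𝔭.asIdeal.inertiaDeg (NumberField.RingOfIntegers ℚ) = 1), ∀ (𝔭' : IsDedekindDomain.HeightOneSpectrum (NumberField.RingOfIntegers K)), ((3 : ℕ) : NumberField.RingOfIntegers K) ∈ 𝔭'.asIdeal → 𝔭' ≠ 𝔭 → ∀ (ι' : PadicAlgCl 3 ≃+* ℂ), Summit.BirchSwinnertonDyer.BirchSwinnertonDyer.Theorems.SchneiderFree.BranchInducesPrime 3 ι' 𝔭 → ∀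 (ΩK : ℂ) (Ωp : ℂ_[3]) (L : Literature.NumberTheory.EllipticCurves.UnrSeries 3), ΩK ≠ 0 → Ωp ≠ 0 → Literature.NumberTheory.EllipticCurves.IsBDPLFunction ι' 𝔭 κ γ Dt.f ΩK Ωp L → Module.IsTorsion (Literature.NumberTheory.EllipticCurves.IwasawaAlgebra 3) (Summit.BirchSwinnertonDyer.Rank1Residual.X11b.AcSelmer.XAc (W.baseChange K) 3 κ 𝔭' ∅ γ) → ∀ (u : (Literature.NumberTheory.EllipticCurves.unrIntegers 3)ˣ), L.HasValueAt 0 ((((u : Literature.NumberTheory.EllipticCurves.unrIntegers 3) : Literature.NumberTheory.EllipticCurves.unrIntegers 3) : ℂ_[3]) * (algebraMap ℚ_[3] ℂ_[3] (Summit.BirchSwinnertonDyer.Rank1Residual.X11b.Halves.logOmega W 3 (Summit.BirchSwinnertonDyer.Rank1Residual.X11b.embAt K 3 𝔭 h𝔭 he hf) P / (Dt.c : ℚ_[3]))) ^ 2) → ‖algebraMap ℚ_[3] ℂ_[3] (Summit.BirchSwinnertonDyer.Rank1Residual.X11b.Halves.logOmega W 3 (Summit.BirchSwinnertonDyer.Rank1Residual.X11b.embAt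 K 3 𝔭 h𝔭 he hf) P / (Dt.c : ℚ_[3]))‖ < 1 → ∀ (f : Literature.NumberTheory.EllipticCurves.IwasawaAlgebra 3), Summit.BirchSwinnertonDyer.Rank1Residual.X11b.AcSelmer.XAc.charIdeal (W.baseChange K) 3 κ 𝔭' ∅ γ = Ideal.span {f} → ‖((PowerSeries.constantCoeff f : ℤ_[3]) : ℚ_[3])‖ ≤ ‖((PowerSeries.constantCoeff L : Literature.NumberTheory.EllipticCurves.unrIntegers 3) : ℂ_[3])‖) :
    WildSplitEisensteinValueAtOneV :=
  valueAtOneV_iff_lExcess.mpr h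

end Summit.BirchSwinnertonDyer.BirchSwinnertonDyer.Theorems.WildSplitEisensteinValueAtOneVLIdle

end
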